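import Summits.RiemannHypothesis.RiemannHypothesis.Theorems.NymanBeurlingFareyMean
import Literature.Analysis.SpecialFunctions.KernelLog
import HarnessLib

/-!
# RiemannHypothesis / Nyman–Beurling — `Q` to nine decimals, I: the KERNEL CERTIFICATE (head `n ≤ 400` by interval arithmetic)

Column LI/NB, rung L-P(P2), PROOF-OF-DATA for cell `pub/rh-li` [rh-li-eng-3 g5].  Computable fixed-point enclosures (scale `2⁸⁰`,
outward rounding) of `t_n = m_n²/(n(n+1))`, `m_n = n(n+1) log(1+1/n) − n`, from the tree's interval logarithm
`Literature.Analysis.SpecialFunctions.KernelLog.log1pIv` (`log1pIv_sound`): `termIv`, the head accumulator `hAcc` (`n = 2..K+1`),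
the rational-sum accumulator `fAcc` (`F₁(M) = Σ_{n≤M} 1/(n(n+1)(2n+1))`), their soundness theorems (`termIv_sound`, `hAcc_sound`,
`fAcc_sound`), the rational enclosure constants of `log 2`, `log π`, `γ` (as in the tree's 20/16-decimal theorems), and the Boolean
test `qCheck` (head `K = 399`, `M = 400`) with `qCheck_eq : qCheck = true` by `decide +kernel`.  The sequel
`NymanBeurlingQDigits.lean` turns the test into `|Q − 0.0803270395| ≤ 10⁻⁹`.
RH-FREE [rh-li-eng-3 g5]: certified numerics; nothing here bears on the truth of RH.
-/

noncomputable section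

set_option linter.dupNamespace false

open Filter Set Topology Finset
open scoped Real

namespace Summit.RiemannHypothesis.RiemannHypothesis.Theorems.NbTheory

open Literature.NumberTheory.LFunctions Literature.Analysis.SpecialFunctions.KernelLog

namespace QDigits

/-- Scaled enclosure of `t_n = m_n²/(n(n+1))` (`n ≥ 2`) at scale `2⁸⁰`, from `log1pIv 1 n ∋ log(1 + 1/n)`. -/
def termIv (n : ℕ) : Option (ℤ × ℤ) :=
  match log1pIv 1 n with
  | none => none
  | some (l, h) =>
    if 0 ≤ ((n : ℤ) * (n + 1)) * l - n * LOGSC then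
      some ((((n : ℤ) * (n + 1)) * l - n * LOGSC) * (((n : ℤ) * (n + 1)) * l - n * LOGSC) / (LOGSC * ((n : ℤ) * (n + 1))),
        -((-((((n : ℤ) * (n + 1)) * h - n * LOGSC) * (((n : ℤ) * (n + 1)) * h - n * LOGSC))) /
          (LOGSC * ((n : ℤ) * (n + 1)))))
    else none

/-- Scaled enclosure of the head `Σ_{n=2}^{K+1} t_n`. -/
def hAcc : ℕ → Option (ℤ × ℤ)
  | 0 => some (0, 0)
  | k + 1 =>
    match hAcc k, termIv (k + 2) with
    | some (a, b), some (tl, th) => some (a + tl, b + th)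
    | _, _ => none

/-- Scaled enclosure of `F₁(M) = Σ_{n=1}^{M} 1/(n(n+1)(2n+1))`. -/
def fAcc : ℕ → ℤ × ℤ
  | 0 => (0, 0)
  | k + 1 =>
    let d : ℤ := ((k : ℤ) + 1) * (k + 2) * (2 * k + 3)
    ((fAcc k).1 + LOGSC / d, (fAcc k).2 + -((-LOGSC) / d))

/-! ## Soundness of the kernel computation -/

/-- `LOGSC = 2⁸⁰` as a real number. -/
lemma cast_LOGSC : ((LOGSC : ℤ) : ℝ) = 2 ^ 80 := by
  norm_num [LOGSC]

/-- **Soundness of `termIv`**: `tl/2⁸⁰ ≤ m_n²/(n(n+1)) ≤ th/2⁸⁰` (`n ≥ 2`). -/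
theorem termIv_sound {n : ℕ} (hn : 2 ≤ n) {tl th : ℤ} (h : termIv n = some (tl, th)) :
    (tl : ℝ) / 2 ^ 80 ≤ nbFareyMean n ^ 2 / ((n : ℝ) * ((n : ℝ) + 1)) ∧
      nbFareyMean n ^ 2 / ((n : ℝ) * ((n : ℝ) + 1)) ≤ (th : ℝ) / 2 ^ 80 := by
  unfold termIv at h
  split at h
  · simp at h
  · rename_i l hh hlog
    split_ifs at h with hpos
    simp only [Option.some.injEq, Prod.mk.injEq] at h
    obtain ⟨htl, hth⟩ := h
    obtain ⟨hl, hh'⟩ := log1pIv_sound hlog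
    have hn0 : (0 : ℝ) < n := by exact_mod_cast (show 0 < n by omega)
    have hN : (0 : ℝ) < (n : ℝ) * ((n : ℝ) + 1) := by positivity
    have hS : (0 : ℝ) < (2 : ℝ) ^ 80 := by positivity
    -- `m_n = n(n+1) log(1+1/n) − n`
    have hm : nbFareyMean n = (n : ℝ) * (n + 1) * Real.log (1 + 1 / n) - n :=
      FareyMean.nbFareyMean_of_pos (by omega)
    have hlog1 : Real.log (1 + ((1 : ℕ) : ℝ) / (n : ℕ)) = Real.log (1 + 1 / (n : ℝ)) := by push_cast; rfl
    rw [hlog1] at hl hh'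
    set L := Real.log (1 + 1 / (n : ℝ)) with hL
    set m := nbFareyMean n with hmdef
    -- scaled bounds `μlo ≤ 2⁸⁰ m ≤ μhi`
    set μlo : ℝ := (((((n : ℤ) * (n + 1)) * l - n * LOGSC : ℤ)) : ℝ) with hμlo
    set μhi : ℝ := (((((n : ℤ) * (n + 1)) * hh - n * LOGSC : ℤ)) : ℝ) with hμhi
    have hμlo' : μlo = (n : ℝ) * ((n : ℝ) + 1) * l - n * 2 ^ 80 := by
      rw [hμlo]; push_cast; rw [cast_LOGSC]
    have hμhi' : μhi = (n : ℝ) * ((n : ℝ) + 1) * hh - n * 2 ^ 80 := by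
      rw [hμhi]; push_cast; rw [cast_LOGSC]
    have h1 : μlo ≤ 2 ^ 80 * m := by
      rw [hμlo', hm]
      have : (n : ℝ) * ((n : ℝ) + 1) * (l : ℝ) ≤ (n : ℝ) * ((n : ℝ) + 1) * (2 ^ 80 * L) := by
        refine mul_le_mul_of_nonneg_left ?_ hN.le
        rw [div_le_iff₀ hS] at hl; linarith
      nlinarith
    have h2 : 2 ^ 80 * m ≤ μhi := by
      rw [hμhi', hm]
      have : (n : ℝ) * ((n : ℝ) + 1) * (2 ^ 80 * L) ≤ (n : ℝ) * ((n : ℝ) + 1) * (hh : ℝ) := by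
        refine mul_le_mul_of_nonneg_left ?_ hN.le
        rw [le_div_iff₀ hS] at hh'; linarith
      nlinarith
    have h0 : 0 ≤ μlo := by rw [hμlo]; exact_mod_cast hpos
    have hsq1 : μlo ^ 2 ≤ (2 ^ 80 * m) ^ 2 := pow_le_pow_left₀ h0 h1 2
    have hsq2 : (2 ^ 80 * m) ^ 2 ≤ μhi ^ 2 := pow_le_pow_left₀ (h0.trans h1) h2 2
    -- the divisor
    have hd : (0 : ℤ) < LOGSC * ((n : ℤ) * (n + 1)) := by
      have : (0 : ℤ) < LOGSC := by simp [LOGSC]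
      have hn' : (0 : ℤ) < n := by exact_mod_cast (show 0 < n by omega)
      positivity
    have hdR : (((LOGSC * ((n : ℤ) * (n + 1)) : ℤ)) : ℝ) = 2 ^ 80 * ((n : ℝ) * ((n : ℝ) + 1)) := by
      push_cast; rw [cast_LOGSC]
    constructor
    · -- floor
      have hf := (ediv_bounds_real ((((n : ℤ) * (n + 1)) * l - n * LOGSC) * (((n : ℤ) * (n + 1)) * l - n * LOGSC))
        (LOGSC * ((n : ℤ) * (n + 1))) hd).1
      rw [htl] at hf
      rw [hdR] at hf
      have hf' : (tl : ℝ) ≤ μlo ^ 2 / (2 ^ 80 * ((n : ℝ) * ((n : ℝ) + 1))) := by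
        rw [hμlo, sq]; push_cast at hf ⊢; exact hf
      rw [div_le_iff₀ hS]
      have key : μlo ^ 2 / (2 ^ 80 * ((n : ℝ) * ((n : ℝ) + 1))) ≤ m ^ 2 / ((n : ℝ) * ((n : ℝ) + 1)) * 2 ^ 80 := by
        rw [div_le_iff₀ (by positivity)]
        calc μlo ^ 2 ≤ (2 ^ 80 * m) ^ 2 := hsq1
          _ = m ^ 2 / ((n : ℝ) * ((n : ℝ) + 1)) * 2 ^ 80 * (2 ^ 80 * ((n : ℝ) * ((n : ℝ) + 1))) := by
            field_simp
      linarith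
    · -- ceiling
      have hc := (ediv_bounds_real (-((((n : ℤ) * (n + 1)) * hh - n * LOGSC) * (((n : ℤ) * (n + 1)) * hh - n * LOGSC)))
        (LOGSC * ((n : ℤ) * (n + 1))) hd).1
      -- `th = −((−μhi²)/d) ≥ μhi²/d`
      have hc' : μhi ^ 2 / (2 ^ 80 * ((n : ℝ) * ((n : ℝ) + 1))) ≤ (th : ℝ) := by
        rw [← hth]
        push_cast
        rw [hdR] at hc
        rw [hμhi, sq]
        push_cast at hc ⊢
        have : -( (((n : ℝ) * ((n : ℝ) + 1)) * (hh : ℝ) - (n : ℝ) * ((LOGSC : ℤ) : ℝ)) *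
            (((n : ℝ) * ((n : ℝ) + 1)) * (hh : ℝ) - (n : ℝ) * ((LOGSC : ℤ) : ℝ))) /
            (2 ^ 80 * ((n : ℝ) * ((n : ℝ) + 1))) =
            -((((n : ℝ) * ((n : ℝ) + 1)) * (hh : ℝ) - (n : ℝ) * ((LOGSC : ℤ) : ℝ)) *
            (((n : ℝ) * ((n : ℝ) + 1)) * (hh : ℝ) - (n : ℝ) * ((LOGSC : ℤ) : ℝ)) /
            (2 ^ 80 * ((n : ℝ) * ((n : ℝ) + 1)))) := by ring
        linarith
      rw [le_div_iff₀ hS]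
      have key : m ^ 2 / ((n : ℝ) * ((n : ℝ) + 1)) * 2 ^ 80 ≤ μhi ^ 2 / (2 ^ 80 * ((n : ℝ) * ((n : ℝ) + 1))) := by
        rw [le_div_iff₀ (by positivity)]
        calc m ^ 2 / ((n : ℝ) * ((n : ℝ) + 1)) * 2 ^ 80 * (2 ^ 80 * ((n : ℝ) * ((n : ℝ) + 1)))
            = (2 ^ 80 * m) ^ 2 := by field_simp
          _ ≤ μhi ^ 2 := hsq2
      linarith

/-- **Soundness of `hAcc`**: the head `Σ_{k<K} m_{k+2}²/((k+2)(k+3))` is enclosed. -/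
theorem hAcc_sound : ∀ (K : ℕ) {a b : ℤ}, hAcc K = some (a, b) →
    (a : ℝ) / 2 ^ 80 ≤ ∑ k ∈ Finset.range K,
        nbFareyMean (k + 2) ^ 2 / ((((k + 2 : ℕ) : ℝ)) * (((k + 2 : ℕ) : ℝ) + 1)) ∧
      ∑ k ∈ Finset.range K, nbFareyMean (k + 2) ^ 2 / ((((k + 2 : ℕ) : ℝ)) * (((k + 2 : ℕ) : ℝ) + 1)) ≤
        (b : ℝ) / 2 ^ 80
  | 0, a, b, h => by
    simp only [hAcc, Option.some.injEq, Prod.mk.injEq] at h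
    obtain ⟨rfl, rfl⟩ := h
    simp
  | K + 1, a, b, h => by
    unfold hAcc at h
    cases hK : hAcc K with
    | none => simp [hK] at h
    | some p =>
      obtain ⟨a', b'⟩ := p
      cases hT : termIv (K + 2) with
      | none => simp [hK, hT] at h
      | some q =>
        obtain ⟨tl, th⟩ := q
        simp only [hK, hT, Option.some.injEq, Prod.mk.injEq] at h
        obtain ⟨rfl, rfl⟩ := h
        obtain ⟨ih1, ih2⟩ := hAcc_sound K hK
        obtain ⟨ht1, ht2⟩ := termIv_sound (by omega : 2 ≤ K + 2) hT
        rw [Finset.sum_range_succ]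
        constructor <;> (rw [Int.cast_add, add_div]; linarith)

/-- **Soundness of `fAcc`**: `F₁(M) = Σ_{k<M} 1/((k+1)(k+2)(2k+3))` is enclosed. -/
theorem fAcc_sound : ∀ (M : ℕ),
    (((fAcc M).1 : ℤ) : ℝ) / 2 ^ 80 ≤ ∑ k ∈ Finset.range M, 1 / (((k : ℝ) + 1) * ((k : ℝ) + 2) * (2 * k + 3)) ∧
      ∑ k ∈ Finset.range M, 1 / (((k : ℝ) + 1) * ((k : ℝ) + 2) * (2 * k + 3)) ≤ (((fAcc M).2 : ℤ) : ℝ) / 2 ^ 80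
  | 0 => by simp [fAcc]
  | M + 1 => by
    obtain ⟨ih1, ih2⟩ := fAcc_sound M
    have hS : (0 : ℝ) < (2 : ℝ) ^ 80 := by positivity
    have hd : (0 : ℤ) < ((M : ℤ) + 1) * (M + 2) * (2 * M + 3) := by positivity
    have hdR : ((((M : ℤ) + 1) * (M + 2) * (2 * M + 3) : ℤ) : ℝ) = ((M : ℝ) + 1) * ((M : ℝ) + 2) * (2 * M + 3) := by
      push_cast; ring
    have hdpos : (0 : ℝ) < ((M : ℝ) + 1) * ((M : ℝ) + 2) * (2 * M + 3) := by positivity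
    have hf := (ediv_bounds_real LOGSC (((M : ℤ) + 1) * (M + 2) * (2 * M + 3)) hd).1
    have hc := (ediv_bounds_real (-LOGSC) (((M : ℤ) + 1) * (M + 2) * (2 * M + 3)) hd).1
    rw [hdR, cast_LOGSC] at hf
    rw [hdR] at hc
    push_cast at hc
    rw [cast_LOGSC] at hc
    have hsum : ∑ k ∈ Finset.range (M + 1), 1 / (((k : ℝ) + 1) * ((k : ℝ) + 2) * (2 * k + 3)) =
        ∑ k ∈ Finset.range M, 1 / (((k : ℝ) + 1) * ((k : ℝ) + 2) * (2 * k + 3)) +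
          1 / (((M : ℝ) + 1) * ((M : ℝ) + 2) * (2 * M + 3)) := by
      rw [Finset.sum_range_succ]
    have e1 : (((fAcc (M + 1)).1 : ℤ) : ℝ) =
        (((fAcc M).1 : ℤ) : ℝ) + (((LOGSC / (((M : ℤ) + 1) * (M + 2) * (2 * M + 3)) : ℤ)) : ℝ) := by
      simp only [fAcc]; push_cast; ring
    have e2 : (((fAcc (M + 1)).2 : ℤ) : ℝ) =
        (((fAcc M).2 : ℤ) : ℝ) - ((((-LOGSC) / (((M : ℤ) + 1) * (M + 2) * (2 * M + 3))) : ℤ) : ℝ) := by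
      simp only [fAcc]; push_cast; ring
    rw [hsum, e1, e2]
    constructor
    · have : (((LOGSC / (((M : ℤ) + 1) * (M + 2) * (2 * M + 3)) : ℤ)) : ℝ) / 2 ^ 80 ≤
          1 / (((M : ℝ) + 1) * ((M : ℝ) + 2) * (2 * M + 3)) := by
        rw [div_le_iff₀ hS]
        calc (((LOGSC / (((M : ℤ) + 1) * (M + 2) * (2 * M + 3)) : ℤ)) : ℝ)
            ≤ 2 ^ 80 / (((M : ℝ) + 1) * ((M : ℝ) + 2) * (2 * M + 3)) := hf
          _ = 1 / (((M : ℝ) + 1) * ((M : ℝ) + 2) * (2 * M + 3)) * 2 ^ 80 := by ring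
      rw [add_div]
      linarith
    · have : 1 / (((M : ℝ) + 1) * ((M : ℝ) + 2) * (2 * M + 3)) ≤
          -(((((-LOGSC) / (((M : ℤ) + 1) * (M + 2) * (2 * M + 3))) : ℤ) : ℝ) / 2 ^ 80) := by
        have h1 : (((((-LOGSC) / (((M : ℤ) + 1) * (M + 2) * (2 * M + 3))) : ℤ) : ℝ) / 2 ^ 80) ≤
            -(1 / (((M : ℝ) + 1) * ((M : ℝ) + 2) * (2 * M + 3))) := by
          rw [div_le_iff₀ hS]
          have : -(2 : ℝ) ^ 80 / (((M : ℝ) + 1) * ((M : ℝ) + 2) * (2 * M + 3)) =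
              -(1 / (((M : ℝ) + 1) * ((M : ℝ) + 2) * (2 * M + 3))) * 2 ^ 80 := by ring
          linarith
        linarith
      rw [sub_div]
      linarith

/-! ## The certificate -/

/-- Rational enclosure constants: `log 2`, `log π` (20 decimals, tree), `γ` (16 decimals, tree). -/
def L2LOq : ℚ := 0.69314718055994530940
/-- see `L2LOq` -/
def L2HIq : ℚ := 0.69314718055994530944
/-- see `L2LOq` -/
def LPILOq : ℚ := 1.14472988584940017414
/-- see `L2LOq` -/
def LPIHIq : ℚ := 1.14472988584940017415
/-- see `L2LOq` -/
def GLOq : ℚ := 0.5772156649015328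
/-- see `L2LOq` -/
def GHIq : ℚ := 0.5772156649015405

/-- The rational part of the lower bound for `Q`, minus the target `0.0803270395 − 10⁻⁹`. -/
def QLOq : ℚ :=
  (L2LOq + LPILOq - GHIq - 1) - (2 * L2HIq - 1) ^ 2 / 2 - 1 / (4 * 401) + (3 - 4 * L2HIq) / 3
    - 1 / (108 * (400 * 401 * 402)) - (0.0803270395 - 1 / 10 ^ 9)

/-- The rational part of the upper bound for `Q`, minus the target `0.0803270395 + 10⁻⁹`. -/
def QHIq : ℚ :=
  (L2HIq + LPIHIq - GLOq - 1) - (2 * L2LOq - 1) ^ 2 / 2 - 1 / (4 * 401) + (3 - 4 * L2LOq) / 3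
    - (0.0803270395 + 1 / 10 ^ 9)

/-- **The kernel test**: head `n = 2..400` (`hAcc 399`) and `F₁(400)` (`fAcc 400`) against the rational constants. -/
def qCheck : Bool :=
  match hAcc 399 with
  | some (a, b) =>
    decide ((3 * b + (fAcc 400).2 : ℚ) ≤ 3 * 2 ^ 80 * QLOq) &&
      decide (3 * 2 ^ 80 * QHIq ≤ (3 * a + (fAcc 400).1 : ℚ))
  | none => false

/-- The kernel test passes. -/
theorem qCheck_eq : qCheck = true := by
  decide +kernel

end QDigits

end Summit.RiemannHypothesis.RiemannHypothesis.Theorems.NbTheory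

end
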